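import Mathlib
import HarnessLib
import Summits.Langlands.Langlands.Theses.NonParallelVoid
import Summits.Langlands.Langlands.Theorems.TriangulineChamberLiftB2CrysSplitPCompletion
import Literature.NumberTheory.GaloisRepresentations.LocalGaloisGroup
import Literature.NumberTheory.GaloisRepresentations.DecompositionGroupOfCompletion
import Literature.NumberTheory.GaloisRepresentations.AbsGaloisOuterConj
import Literature.NumberTheory.GaloisRepresentations.ModPGaloisRep
import Literature.NumberTheory.GaloisRepresentations.ModPGaloisRepCyclotomicProofs
import Literature.NumberTheory.GaloisRepresentations.CalegariEvenFontaineMazurTwo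
import Literature.NumberTheory.GaloisRepresentations.LocalKroneckerWeberInertiaProofs
import Literature.NumberTheory.Automorphic.AdicCompletionResidueCard
import Literature.NumberTheory.PAdicHodge.FontaineDpst
import Literature.NumberTheory.GaloisRepresentations.WildInertia
import Literature.NumberTheory.GaloisRepresentations.LocalGaloisGroupFrobeniusProofs
import Summits.Langlands.Langlands.Theorems.NonParallelVoidEmptyWeightCoreStubSplitPrime
import Summits.Langlands.Langlands.Theorems.NonParallelVoidEmptyWeightCoreStubResidualDet
import Summits.Langlands.Langlands.Theorems.NonParallelVoidEmptyWeightCoreStubInertiaTransport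
import Summits.Langlands.Langlands.Theorems.NonParallelVoidEmptyWeightCoreStubCyclotomicOuterConj
import Summits.Langlands.Langlands.Theorems.NonParallelVoidEmptyWeightCoreStubCyclotomicResidue

/-!
# Line `local-clause-cut` for crux stmt-Langlands-17008 — lead's reshape (cycle 1)
`Summit.Langlands.Langlands.Theses.NonParallelVoid.EmptyWeightCore` (route `route-Langlands-NonParallelVoid`, rank 2)

Mechanism (unchanged from `Lines/birth.lean`, `Lines/local_clause_cut.lean`, idea
`det-parity-empties-core`): the crux's regime — `p ≥ 11` SPLIT in the quadratic field `F`, `ρ`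
CRYSTALLINE at the places above `p` for the pinned Fontaine datum, `ρ̄` of BASE-CHANGE TYPE, and ODD
gap sum `(b - a) + (b' - a')` — is EMPTY, because `det ρ|I_{F_u} = ε^{-(a_u+b_u)}` at each `u ∣ p`
(clause (F12) of the pin) and base-change type transports the inertial determinant between the two
places above `p` up to the square of an (abstract) character `χ`, whose parity obstruction is purely
local: `χ² = ω̄ⁿ` on `I_K` (`K = F_w ≅ ℚ_p`, `p` odd, `χ` a character of `Γ_K`) forces `n` even
(Frobenius acts on tame inertia by `u ↦ u^p`, the wild inertia is pro-`p` hence 2-divisible, and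
`ω̄(I_K) = 𝔽_pˣ` has even order).

## Reshape (lead, 2026-08-17): S2/S3 of the strategist's cut → local pieces served by tree API

* `stub_pinnedCrystallineDetLocal` (S1) — VERBATIM the registered stub.  TRUE for Fontaine's datum and
  provable in one line from clause (F12) (`FontaineDatumExists.pinnedCrystallineDetOnInertia`,
  `CrystallineDetOnInertia.det_eq_of_labelledHodgeTateWeights_eq_pair`) UNDER the T0 named fact
  `Literature.NumberTheory.PAdicHodge.FontaineDatumExists`; NOT provable without it (`fontainePst` is
  Hilbert's `ε`; a datum on `B_dR` declaring every de Rham `ρ` crystalline meets the structure axioms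
  and violates S1).  Status: BLOCKED on `FontaineDatumExists`; conditional proof landed as `--supports`.
* `stub_splitPrime` — a split prime of a quadratic field has `e = f = 1` at every place above it:
  `N v = p`, `v² ∤ (p)`, and `p` is a uniformiser of `F_v`.
* `stub_residualDet` — `det ρ̄(g) = det ρ(g) mod 𝔪_{ℤ̄_p}` for the tree's `residualRep` in rank 2.
* `stub_inertiaTransport` — for `τ ∈ Γ_ℚ ∖ res Γ_F` and distinct places `v ≠ w` above `p`, the outer
  automorphism `θ_τ` carries `res_w(I_{F_w})` into a `Γ_F`-conjugate of `res_v(I_{F_v})`.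
* `stub_cyclotomicOuterConj` — `ε_F (g⁻¹ θ_τ(x) g) = ε_F (x)`.
* `stub_cyclotomicResidue` — the powers of `ε(σ)` pushed into `ℤ̄_p` reduce to the powers of
  `ε(σ) mod p` in `ℤ̄_p/𝔪`.
* `stub_localSquareParity` — THE local lemma: `K/ℚ_p` with `e = f = 1`, `p` odd, `χ : Γ_K →* kˣ` an
  abstract character, `χ² = ι(ω̄)ⁿ` on `I_K` ⇒ `n` even.

Composition `EmptyWeightCore_of` below is kernel-checked (no `sorry` outside the stubs).
-/

set_option linter.dupNamespace false
set_option linter.unusedVariables false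

noncomputable section

namespace Summit.Langlands.Langlands.Cruxes.EmptyWeightCore.LocalClauseCut

open Summit.Langlands.Langlands.Theses.NonParallelVoid
open Literature.NumberTheory.GaloisRepresentations Literature.NumberTheory.PAdicHodge
open Field IsDedekindDomain NumberField ValuativeRel
open Literature.NumberTheory.GaloisRepresentations.IsNonarchimedeanLocalField (residueFieldCard)

/-! ## 1. The stubs -/

/-- **STUB S1 — the pinned datum's crystalline determinant on LOCAL inertia** (verbatim the
registered stub of `Lines/local_clause_cut.lean`).  For `F` quadratic, `p` split, `v ∣ p`, `ρ_v`
crystalline for THE pinned datum `D_v` with `HT_τ(ρ_v) = {a, b}`: `det ρ_v(σ) = ε_{F_v}(σ)^{-(a+b)}`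
for `σ ∈ I_{F_v}`.  TRUE for Fontaine's datum (clause (F12)); provable under `FontaineDatumExists`
(conditional proof landed separately); BLOCKED unconditionally (the WD half of `fontainePst` is `ε`).
[cite: BrinonConrad2009, Prop. 8.3.4 and Prop. 9.1.11] [cite: Conrad2011LiftingGlobal, Appendix B, Prop. B.4] -/
theorem stub_pinnedCrystallineDetLocal :
    ∀ (F : Type) [Field F] [NumberField F] [Algebra.IsQuadraticExtension ℚ F] (p : ℕ) [Fact p.Prime]
      (ρ : Literature.NumberTheory.GaloisRepresentations.FramedGaloisRep F (PadicAlgCl p) 2),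
      (∃ v w : IsDedekindDomain.HeightOneSpectrum (NumberField.RingOfIntegers F), v ≠ w ∧
          ((p : ℕ) : NumberField.RingOfIntegers F) ∈ v.asIdeal ∧
          ((p : ℕ) : NumberField.RingOfIntegers F) ∈ w.asIdeal) →
      ∀ (v : IsDedekindDomain.HeightOneSpectrum (NumberField.RingOfIntegers F))
        (hv : ((p : ℕ) : NumberField.RingOfIntegers F) ∈ v.asIdeal),
        (Literature.NumberTheory.PAdicHodge.fontainePstAdicCompletion v p hv).IsCrystallineFramed
            (ρ.toLocal v) →
        letI := (Literature.NumberTheory.PAdicHodge.fontainePstAdicCompletion v p hv).algebra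
        ∀ (τ : v.adicCompletion F →ₐ[ℚ_[p]] PadicAlgCl p) (a b : ℤ),
          ρ.labelledHodgeTateWeightsAt v
              (Literature.NumberTheory.PAdicHodge.fontainePstAdicCompletion v p hv).algebra
              (Literature.NumberTheory.PAdicHodge.fontainePstAdicCompletion v p hv).𝔅 τ.toRingHom =
            {a, b} →
          ∀ σ ∈ Literature.NumberTheory.GaloisRepresentations.absInertia (v.adicCompletion F),
            ((ρ.toLocal v) σ).val.det =
              algebraMap ℚ_[p] (PadicAlgCl p)
                ((((Literature.NumberTheory.GaloisRepresentations.GaloisRep.cyclotomicCharacter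
                      (v.adicCompletion F) p σ : ℤ_[p]ˣ) : ℤ_[p]) : ℚ_[p]) ^ (-(a + b))) := by
  sorry

/-! The five stubs `stub_splitPrime`, `stub_residualDet`, `stub_inertiaTransport`,
`stub_cyclotomicOuterConj`, `stub_cyclotomicResidue` of the cycle-1 skeleton have LANDED (p167490,
p167701, p168036, p168152, p168380) and are IMPORTED above under the same names; the cycle-1 stub
`stub_localSquareParity` is re-cut below into three independent stubs and DERIVED from them
(`localSquareParity`). -/

/-- **STUB F1 — the wild inertia group is 2-divisible.**  For a non-archimedean local field `K` with
ODD residue characteristic and a uniformiser `ϖ`, every element of the wild inertia group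
`P_K = absWildInertia K ϖ` is the square of an element of `P_K`: `P_K` is a closed (hence compact)
subgroup of the profinite `Γ_K` and is pro-`p` (`absWildInertia_isProP_holds`: for every open subgroup
`N` some `π^{p^a} ∈ N`), so for each open normal `N` the element `π^{(p^a+1)/2} ∈ P_K` is a square root
of `π` modulo `N`, and compactness of `P_K` (finite-intersection property over the open normal
subgroups, which intersect in `{1}`) produces a square root in `P_K`.
[cite: SerreLocalFields1979, Ch. IV §2, Cor. 3 of Prop. 7 and Exercises 1–2] [cite: SerreInventiones1972, §1.3] -/
theorem stub_wildInertiaSquare :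
    ∀ (K : Type) [Field K] [ValuativeRel K] [TopologicalSpace K] [IsNonarchimedeanLocalField K]
      (ϖ : 𝒪[K]), Irreducible ϖ → ringChar 𝓀[K] ≠ 2 →
      ∀ π ∈ absWildInertia K ϖ, ∃ y ∈ absWildInertia K ϖ, y * y = π := by
  sorry

/-- **STUB F2 — the mod-`p` cyclotomic character on the inertia of a `p`-adic field with
`e = f = 1`.**  If `K` has residue field `𝔽_p` and uniformiser `p`, then `ω̄ = modPCyclotomicCharacterZMod K p`
is TRIVIAL on the wild inertia `P_K = absWildInertia K p` and takes a value of exact order `p - 1` on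
the inertia group `I_K` (so `ω̄(I_K) = 𝔽_pˣ`).  Both because on `I_K` it is Serre's level-one
fundamental character `ψ₁ = θ_{p-1}` (`coe_fundamentalCharacter_one_eq_modPCyclotomicCharacter`, read
in the residue field `S ⧸ 𝔓` of `K̄` along `ZMod.castHom`), which kills `P_K`
(`kummerCharacterQuot_eq_one_of_mem_absWildInertia`) and hits a primitive `(p-1)`-th root of unity
(`exists_isPrimitiveRoot_kummerCharacter`); `ZMod p → S ⧸ 𝔓` is injective.
[cite: SerreInventiones1972, §1.3 Prop. 2, §1.7 and §1.8 Prop. 8 with Cor.] -/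
theorem stub_modPCyclotomicOnInertia :
    ∀ (K : Type) [Field K] [ValuativeRel K] [TopologicalSpace K] [IsNonarchimedeanLocalField K]
      [CharZero K] (p : ℕ) [Fact p.Prime],
      residueFieldCard K = p → Irreducible ((p : ℕ) : 𝒪[K]) →
      (∀ σ ∈ absWildInertia K ((p : ℕ) : 𝒪[K]), modPCyclotomicCharacterZMod K p σ = 1) ∧
        ∃ σ₀ ∈ absInertia K,
          IsPrimitiveRoot ((modPCyclotomicCharacterZMod K p σ₀ : (ZMod p)ˣ) : ZMod p) (p - 1) := by
  sorry

/-- **STUB F3 — the algebraic core of the parity lemma.**  Let `P ≤ I` be subgroups of a group `G`,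
`φ ∈ G`, `p` an odd prime, with: every element of `P` a square in `P`; `φ σ φ⁻¹ σ^{-p} ∈ P` for
`σ ∈ I` (Frobenius on tame inertia); `ω : G →* (ℤ/p)ˣ` trivial on `P` and with a value of exact order
`p - 1` at some `σ₀ ∈ I`.  If `χ : G →* kˣ` (any field `k`, `ι : ℤ/p →+* k`) satisfies
`χ(σ)² = ι(ω(σ))ⁿ` on `I`, then `n` is even.  (For `σ ∈ I`: `π = φσφ⁻¹σ^{-p} = y²`, `y ∈ P`, so
`χ(π) = χ(y)² = ι(ω y)ⁿ = 1` and `χ(σ)^{p-1} = 1`; at `σ₀`, `g = ι(ω σ₀)` is a primitive `(p-1)`-th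
root of unity, `χ(σ₀) = g^j`, `g^{2j-n} = 1`, `p - 1 ∣ 2j - n`, and `p - 1` is even.) [folklore] -/
theorem stub_squareParityCore :
    ∀ (G : Type) [Group G] (I P : Subgroup G) (φ : G) (p : ℕ) [Fact p.Prime], p ≠ 2 → P ≤ I →
      (∀ π ∈ P, ∃ y ∈ P, y * y = π) →
      (∀ σ ∈ I, φ * σ * φ⁻¹ * (σ ^ p)⁻¹ ∈ P) →
      ∀ (ω : G →* (ZMod p)ˣ), (∀ σ ∈ P, ω σ = 1) →
        (∃ σ₀ ∈ I, IsPrimitiveRoot ((ω σ₀ : (ZMod p)ˣ) : ZMod p) (p - 1)) →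
        ∀ (k : Type) [Field k] (ι : ZMod p →+* k) (χ : G →* kˣ) (n : ℤ),
          (∀ σ ∈ I, ((χ σ : kˣ) : k) ^ 2 = ι ((ω σ : (ZMod p)ˣ) : ZMod p) ^ n) →
          Even n := by
  sorry

/-! ## 2. The stub statements as named `Prop`s (literally their types) -/

namespace _Goal

/-- The statement of `stub_pinnedCrystallineDetLocal`, as a named `Prop` (literally its type). [folklore] -/
def stub_pinnedCrystallineDetLocal : Prop :=
  type_of% @Summit.Langlands.Langlands.Cruxes.EmptyWeightCore.LocalClauseCut.stub_pinnedCrystallineDetLocal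

/-- The statement of `stub_wildInertiaSquare`, as a named `Prop`. [folklore] -/
def stub_wildInertiaSquare : Prop :=
  type_of% @Summit.Langlands.Langlands.Cruxes.EmptyWeightCore.LocalClauseCut.stub_wildInertiaSquare

/-- The statement of `stub_modPCyclotomicOnInertia`, as a named `Prop`. [folklore] -/
def stub_modPCyclotomicOnInertia : Prop :=
  type_of% @Summit.Langlands.Langlands.Cruxes.EmptyWeightCore.LocalClauseCut.stub_modPCyclotomicOnInertia

/-- The statement of `stub_squareParityCore`, as a named `Prop`. [folklore] -/
def stub_squareParityCore : Prop :=
  type_of% @Summit.Langlands.Langlands.Cruxes.EmptyWeightCore.LocalClauseCut.stub_squareParityCore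

end _Goal

/-! ## 3. Seams (proved) -/

/-- **The local parity lemma** (the cycle-1 stub `stub_localSquareParity`, now DERIVED from F1–F3):
`K/ℚ_p` with `e = f = 1`, `p` odd, `χ : Γ_K →* kˣ` an abstract character with `χ² = ι(ω̄)ⁿ` on `I_K`
⇒ `n` even.  The Frobenius input is the tree's `conj_mul_pow_inv_mem_absWildInertia` (Serre:
`s u s⁻¹ ≡ u^q (mod P)`) at an arithmetic Frobenius (`exists_isFrobPow_holds`).
[cite: SerreInventiones1972, §1.8 Prop. 6] -/
theorem localSquareParity (hF1 : _Goal.stub_wildInertiaSquare) (hF2 : _Goal.stub_modPCyclotomicOnInertia)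
    (hF3 : _Goal.stub_squareParityCore) :
    ∀ (K : Type) [Field K] [ValuativeRel K] [TopologicalSpace K] [IsNonarchimedeanLocalField K]
      [CharZero K] (p : ℕ) [Fact p.Prime], p ≠ 2 →
      residueFieldCard K = p → Irreducible ((p : ℕ) : 𝒪[K]) →
      ∀ (k : Type) [Field k] (ι : ZMod p →+* k) (χ : absoluteGaloisGroup K →* kˣ) (n : ℤ),
        (∀ σ ∈ absInertia K,
            ((χ σ : kˣ) : k) ^ 2 = ι ((modPCyclotomicCharacterZMod K p σ : (ZMod p)ˣ) : ZMod p) ^ n) →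
        Even n := by
  have h1 : type_of% @stub_wildInertiaSquare := hF1
  have h2 : type_of% @stub_modPCyclotomicOnInertia := hF2
  have h3 : type_of% @stub_squareParityCore := hF3
  intro K _ _ _ _ _ p _ hp2 hq hirr k _ ι χ n hχ
  -- residue characteristic of `K` is `p`
  have hchar : ringChar 𝓀[K] = p := by
    obtain ⟨f, -, hf⟩ := IsNonarchimedeanLocalField.residueFieldCard_eq_pow_ringChar K
    rw [hq] at hf
    exact ((Fact.out : p.Prime).pow_eq_iff.1 hf.symm).1
  -- an arithmetic Frobenius
  obtain ⟨φ, hφ⟩ := exists_isFrobPow_holds (F := K) ((1 : ℕ) : ℤ)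
  obtain ⟨hω1, σ₀, hσ₀, hprim⟩ := h2 K p hq hirr
  refine h3 (absoluteGaloisGroup K) (absInertia K) (absWildInertia K ((p : ℕ) : 𝒪[K])) φ p hp2
    (absWildInertia_le_absInertia (F := K) _) (h1 K ((p : ℕ) : 𝒪[K]) hirr (by rw [hchar]; exact hp2)) ?_
    (modPCyclotomicCharacterZMod K p) hω1 ⟨σ₀, hσ₀, hprim⟩ k ι χ n hχ
  intro σ hσ
  have h := conj_mul_pow_inv_mem_absWildInertia hirr.ne_zero hφ hσ
  rwa [pow_one, hq] at h


/-- If `-(a + b) - -(a' + b')` is even then the gap sum `(b - a) + (b' - a')` is even. [folklore] -/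
theorem gapSum_even_of_detExponents_even {a b a' b' : ℤ} (h : Even (-(a + b) - -(a' + b'))) :
    Even (b - a + (b' - a')) := by
  obtain ⟨r, hr⟩ := h
  exact ⟨r + b - a', by omega⟩

/-- Two increasing pairs with the same underlying multiset are equal. [folklore] -/
theorem pair_eq_of_lt {a b a' b' : ℤ} (h : ({a, b} : Multiset ℤ) = {a', b'}) (hlt : a < b)
    (hlt' : a' < b') : a = a' ∧ b = b' := by
  have ha : a ∈ ({a', b'} : Multiset ℤ) := h ▸ Multiset.mem_cons_self a _
  have hb : b ∈ ({a', b'} : Multiset ℤ) := h ▸ (Multiset.mem_cons.2 (Or.inr (Multiset.mem_singleton_self b)))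
  simp only [Multiset.insert_eq_cons, Multiset.mem_cons, Multiset.mem_singleton] at ha hb
  omega

/-- The determinant of a representation is invariant under conjugation in the group. [folklore] -/
theorem det_conj_eq {G : Type*} [Group G] [TopologicalSpace G] {R : Type*} [CommRing R]
    [TopologicalSpace R] {n : ℕ} (ρ : G →ₜ* GL (Fin n) R) (g x : G) :
    (ρ (g⁻¹ * x * g)).val.det = (ρ x).val.det := by
  have h : Matrix.GeneralLinearGroup.det (ρ (g⁻¹ * x * g)) = Matrix.GeneralLinearGroup.det (ρ x) := by
    simp only [map_mul, map_inv]
    exact inv_mul_cancel_comm _ _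
  have h' := congrArg Units.val h
  rwa [Matrix.GeneralLinearGroup.val_det_apply, Matrix.GeneralLinearGroup.val_det_apply] at h'

/-! ## 4. The composition (kernel-checked, no `sorry`) -/

/-- **`EmptyWeightCore` from the stubs.** [folklore] -/
theorem EmptyWeightCore_of (h₁ : _Goal.stub_pinnedCrystallineDetLocal) (hF1 : _Goal.stub_wildInertiaSquare)
    (hF2 : _Goal.stub_modPCyclotomicOnInertia) (hF3 : _Goal.stub_squareParityCore) :
    Summit.Langlands.Langlands.Theses.NonParallelVoid.EmptyWeightCore := by
  have hLoc : type_of% @stub_pinnedCrystallineDetLocal := h₁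
  have hSpl := @stub_splitPrime
  have hRes := @stub_residualDet
  have hTra := @stub_inertiaTransport
  have hCyc := @stub_cyclotomicOuterConj
  have hRed := @stub_cyclotomicResidue
  have hPar := localSquareParity hF1 hF2 hF3
  intro F _ _ _ hF p _ ρ hirr hunr hHT hLR hG hnE hBC
  obtain ⟨hp11, hsplit, hcrys, _hresirr⟩ := hG
  refine (hnE ?_).elim
  intro v hv w hw τ σ a b a' b' hab hlt hab' hlt'
  have hSv := hSpl F p hsplit v hv
  have hSw := hSpl F p hsplit w hw
  by_cases hvw : v = w
  · -- ONE place: at a split prime `ℚ_p → F_v` is onto, so the two labels coincide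
    subst hvw
    have hsub : @Subsingleton (letI := (fontainePstAdicCompletion v p hv).algebra;
        v.adicCompletion F →ₐ[ℚ_[p]] PadicAlgCl p) := by
      rw [fontainePstAdicCompletion_algebra_eq_adicCompletionPadicAlgebra v p hv]
      exact Summit.Langlands.Langlands.Theorems.LiftB2CrysSplitP.algHom_adicCompletion_subsingleton_of_split
        v p hv hSv.1 hSv.2.1 _
    have hτσ : τ = σ := Subsingleton.elim _ _
    subst hτσ
    rw [hab] at hab'
    obtain ⟨rfl, rfl⟩ := pair_eq_of_lt hab' hlt hlt'
    exact ⟨b - a, by ring⟩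
  · -- TWO places: transport through the base-change datum and conclude by the local parity lemma
    obtain ⟨τ₀, hτ₀, χ, hχ⟩ := hBC
    haveI : IsGalois ℚ F := Algebra.IsQuadraticExtension.isGalois ℚ F
    obtain ⟨g, hg⟩ := hTra F p τ₀ hτ₀ v w hvw hv hw
    -- S1 at `v` (label `τ`, weights `{a, b}`) and at `w` (label `σ`, weights `{a', b'}`)
    have hv₁ := hLoc F p ρ hsplit v hv (hcrys v hv) τ a b hab
    have hw₁ := hLoc F p ρ hsplit w hw (hcrys w hw) σ a' b' hab'
    haveI hcw : CharZero (w.adicCompletion F) := LocalField.charZero_adicCompletion w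
    have hqw : residueFieldCard (w.adicCompletion F) = p := by
      rw [Literature.NumberTheory.Automorphic.residueFieldCard_adicCompletion_eq]; exact hSw.1
    have key : Even (-(a + b) - -(a' + b')) := by
      refine hPar (w.adicCompletion F) p (by omega) hqw hSw.2.2 (padicAlgClResidueField p)
        (zmodToPadicAlgClResidueField p)
        (χ.comp (absGaloisRestrict F (w.adicCompletion F)).toMonoidHom) _ ?_
      intro s hs
      obtain ⟨s', hs', hres⟩ := hg s hs
      -- the cyclotomic character of `F_v` at `s'` is that of `F_w` at `s`
      have hεv : GaloisRep.cyclotomicCharacter (v.adicCompletion F) p s' =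
          GaloisRep.cyclotomicCharacter (w.adicCompletion F) p s := by
        rw [← cyclotomicCharacter_absGaloisRestrict F (v.adicCompletion F) p s', hres, hCyc F p τ₀ g,
          cyclotomicCharacter_absGaloisRestrict F (w.adicCompletion F) p s]
      -- the two determinants in `ℚ̄_p`
      have h1 : (ρ (absGaloisRestrict F (w.adicCompletion F) s)).val.det =
          algebraMap ℚ_[p] (PadicAlgCl p)
            ((((GaloisRep.cyclotomicCharacter (w.adicCompletion F) p s : ℤ_[p]ˣ) : ℤ_[p]) : ℚ_[p]) ^
              (-(a' + b'))) := hw₁ s hs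
      have h2 : (ρ (absGaloisOuterConj ℚ F τ₀ (absGaloisRestrict F (w.adicCompletion F) s))).val.det =
          algebraMap ℚ_[p] (PadicAlgCl p)
            ((((GaloisRep.cyclotomicCharacter (w.adicCompletion F) p s : ℤ_[p]ˣ) : ℤ_[p]) : ℚ_[p]) ^
              (-(a + b))) := by
        have h2' : ((ρ.toLocal v) s').val.det = _ := hv₁ s' hs'
        rw [hεv, FramedGaloisRep.toLocal_apply, hres, det_conj_eq] at h2'
        exact h2'
      -- their reductions
      obtain ⟨x₁, hx₁, hr₁⟩ := hRed p (GaloisRep.cyclotomicCharacter (w.adicCompletion F) p s) (-(a' + b'))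
      obtain ⟨x₂, hx₂, hr₂⟩ := hRed p (GaloisRep.cyclotomicCharacter (w.adicCompletion F) p s) (-(a + b))
      have hd₁ := hRes F p ρ _ x₁ (by rw [hx₁, h1])
      have hd₂ := hRes F p ρ _ x₂ (by rw [hx₂, h2])
      -- the determinant clause of base-change type at `(res_w s, θ_τ (res_w s))`
      have hcl := (hχ (absGaloisRestrict F (w.adicCompletion F) s)
        (absGaloisOuterConj ℚ F τ₀ (absGaloisRestrict F (w.adicCompletion F) s))
        (absGaloisRestrict_absGaloisOuterConj ℚ F τ₀ _)).2
      rw [hd₁, hd₂, hr₁, hr₂] at hcl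
      -- `ε(s) mod p = ω̄(s)`
      have hζ : zmodToPadicAlgClResidueField p
            (PadicInt.toZMod ((GaloisRep.cyclotomicCharacter (w.adicCompletion F) p s : ℤ_[p]ˣ) : ℤ_[p])) =
          zmodToPadicAlgClResidueField p
            ((modPCyclotomicCharacterZMod (w.adicCompletion F) p s : (ZMod p)ˣ) : ZMod p) := by
        rw [toZMod_cyclotomicCharacter_apply]
      have hζ0 : zmodToPadicAlgClResidueField p
          ((modPCyclotomicCharacterZMod (w.adicCompletion F) p s : (ZMod p)ˣ) : ZMod p) ≠ 0 :=
        (map_ne_zero _).2 (Units.ne_zero _)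
      rw [hζ] at hcl
      rw [zpow_sub₀ hζ0, hcl, MonoidHom.comp_apply, mul_div_assoc, div_self (zpow_ne_zero _ hζ0),
        mul_one]
      rfl
    exact gapSum_even_of_detExponents_even key

/-- By-name sanity check (an `example`, not a declaration of the file): the stubs feed the
composition as they stand. -/
example : Summit.Langlands.Langlands.Theses.NonParallelVoid.EmptyWeightCore :=
  EmptyWeightCore_of stub_pinnedCrystallineDetLocal stub_wildInertiaSquare stub_modPCyclotomicOnInertia
    stub_squareParityCore

end Summit.Langlands.Langlands.Cruxes.EmptyWeightCore.LocalClauseCut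

end
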